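import Literature.NumberTheory.EllipticCurves.CyclotomicZpExtension
import Literature.NumberTheory.EllipticCurves.ZpExtensionProofs
import Literature.NumberTheory.GaloisRepresentations.LocalKroneckerWeberInertiaProofs
import Literature.NumberTheory.GaloisRepresentations.CubicReciprocityRationalPrime
import HarnessLib

/-!
# The cyclotomic `ℤ_p`-extension of a QUADRATIC field, constructed (`κ = ℓ ∘ χ_p|Γ_L`, `p` odd);
# discharge of the inline hypothesis `hexK` of line V14 (`K = ℚ(ζ₃)`, `p = 3`)

HONEST FRAMING (cell `b2b-bsdres`, run/shared/lean/b2b/bsd-rank1-residual/, verbatim in every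
file): the goal of the cell is to DELETE the COMBINATION-SHAPED residual classes of the
Birch–Swinnerton-Dyer formula for ALL analytic-rank `≤ 1` elliptic curves over `ℚ` — "full BSD
formula for every rank `≤ 1` curve in class `C`" assembled STRICTLY from published theorems — so
that the rank-`≤ 1` remainder becomes exactly the CONSTRUCTION-SHAPED classes, which are TYPED
(missing-input `Prop`s), NOT attempted. This is not "finishing BSD". The additive sub-cell (seats
additive-p1…p4) is a RESEARCH ROUTE on the construction-shaped classes X3/X4; no claim beyond the
stated classes; the labels of X3 (and of X1, the class of the twist pairs) are UNCHANGED by this file;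
nothing is booked here (booking is the referee's call).

Theorems only (no `def`, no `sorry`, no named fact). The core theorem of line V14
(`X3CyclotomicThree.exists_padicVal_shaOrder_add_le`, file `X3RankZeroCyclotomicThree.lean`) and its
corollaries carry the ROUTINE inline hypothesis

  `hexK : ∃ κ : ZpExtension K 3, κ.IsCyclotomic ∧ ∃ γ, κ.IsTopGenerator γ ∧ ∃ ζ : ℤ₃ˣ,`
  `  IsOfFinOrder ζ ∧ χ₃(γ)·ζ = γ_cyc (= 4)`

— the cyclotomic `ℤ₃`-extension `K_∞ = ℚ(μ_{3^∞})` of `K = ℚ(ζ₃)` with a normalised topological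
generator (Washington, *Introduction to Cyclotomic Fields*, §13.1). This file PROVES it, as the
quadratic twin of the tree's construction over `ℚ` (`Literature.NumberTheory.EllipticCurves.CyclotomicZp.zpExtension`,
`κ_cyc = ℓ ∘ χ_p`, file `CyclotomicZpExtension.lean`):

* `exists_zpExtension_isCyclotomic_of_finrank_eq_two` — for ANY number field `L` with `[L : ℚ] = 2`
  and ANY odd prime `p`, `κ_L := ℓ ∘ χ_p|Γ_L : Γ_L →ₜ* ℤ_p` (`ℓ = log_p/log_p(γ_cyc)` the tree's
  normalised logarithm `CyclotomicZp.ell`, `ker ℓ = μ(ℤ_p)`, `ℓ(γ_cyc^x) = x`) is SURJECTIVE, hence a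
  `ℤ_p`-extension, it is cyclotomic (`ker κ_L = χ_p⁻¹(μ(ℤ_p))`), and there is `γ ∈ Γ_L` with
  `κ_L(γ) = 1` and `χ_p(γ) = γ_cyc = 1 + p` EXACTLY. Surjectivity ("`χ_p(Γ_L) ⊇ 1 + pℤ_p`") by the
  squaring trick: for `x ∈ ℤ_p` write `x = w + w` (`2 ∈ ℤ_pˣ`), pick `g ∈ Γ_ℚ` with `χ_p(g) = γ_cyc^w`
  (`χ_p : Γ_ℚ → ℤ_pˣ` is onto, tree `cyclotomicCharacter_rat_surjective`); the image of `Γ_L → Γ_ℚ`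
  has index `≤ 2 = [L : ℚ]` (tree `inv_mul_mem_range_absGaloisRestrict`), so `g² = res σ` with
  `σ ∈ Γ_L`, and `χ_p(σ) = χ_p(res σ) = χ_p(g)² = γ_cyc^x` (tree `cyclotomicCharacter_absGaloisRestrict`).
* `exists_isCyclotomic_isTopGenerator_cyclotomicThree` — the literal `hexK` for `K = ℚ(ζ₃)`
  (`IsCyclotomicExtension {3} ℚ K`, `[K : ℚ] = 2`), `p = 3`, with `ζ = 1`.

References: L. C. Washington, *Introduction to Cyclotomic Fields*, GTM 83, §13.1 (the cyclotomic
`ℤ_p`-extension of a number field); J.-P. Serre, *A Course in Arithmetic*, II.3.2 (`ℤ_pˣ = μ × U₁`).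
-/

noncomputable section

open Field

namespace Summit.BirchSwinnertonDyer.Rank1Residual.Additive

open Literature.NumberTheory.EllipticCurves Literature.NumberTheory.EllipticCurves.CyclotomicZp
  Literature.NumberTheory.GaloisRepresentations

section Quadratic

variable (L : Type) [Field L] [NumberField L] (p : ℕ) [Fact p.Prime]

/-- `γ_cyc^a · γ_cyc^b = γ_cyc^{a+b}` as units of `ℤ_p`. [folklore] -/
theorem cycPowUnit_mul_cycPowUnit (a b : ℤ_[p]) :
    cycPowUnit p a * cycPowUnit p b = cycPowUnit p (a + b) := by
  ext
  rw [Units.val_mul, val_cycPowUnit, val_cycPowUnit, val_cycPowUnit, ← AddChar.map_add_eq_mul]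

/-- **The square of any `g ∈ Γ_ℚ` is a restriction from `Γ_L`** when `[L : ℚ] = 2`: the image of
`Γ_L → Γ_ℚ` has index `≤ 2` (tree `inv_mul_mem_range_absGaloisRestrict`). [folklore] -/
theorem sq_mem_range_absGaloisRestrict_of_finrank_eq_two (h2 : Module.finrank ℚ L = 2)
    (g : absoluteGaloisGroup ℚ) : g ^ 2 ∈ Set.range (absGaloisRestrict ℚ L) := by
  by_cases hg : g ∈ Set.range (absGaloisRestrict ℚ L)
  · obtain ⟨x, rfl⟩ := hg
    exact ⟨x ^ 2, map_pow _ _ _⟩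
  · have hg' : g⁻¹ ∉ Set.range (absGaloisRestrict ℚ L) := by
      rintro ⟨x, hx⟩
      exact hg ⟨x⁻¹, by rw [map_inv, hx, inv_inv]⟩
    have h := inv_mul_mem_range_absGaloisRestrict h2 hg' hg
    rwa [inv_inv, ← pow_two] at h

/-- **`χ_p(Γ_L) ⊇ 1 + p^{e₀}ℤ_p = γ_cyc^{ℤ_p}` for a quadratic field `L` and odd `p`**: every
`γ_cyc^x` is a value of the `p`-adic cyclotomic character on `Γ_L` (squaring trick, module docstring).
[folklore] -/
theorem exists_cyclotomicCharacter_eq_cycPowUnit (h2 : Module.finrank ℚ L = 2) (hp : p ≠ 2)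
    (x : ℤ_[p]) :
    ∃ σ : absoluteGaloisGroup L, GaloisRep.cyclotomicCharacter L p σ = cycPowUnit p x := by
  -- `x = w + w`
  obtain ⟨w, hw⟩ : ∃ w : ℤ_[p], w + w = x := by
    -- `2 ∈ ℤ_pˣ` for odd `p` (also the tree's `WeierstrassCurve.isUnit_two_padicInt`, not imported)
    have h2u : IsUnit (2 : ℤ_[p]) := by
      rw [PadicInt.isUnit_iff]
      refine le_antisymm (PadicInt.norm_le_one _) (not_lt.mp fun hlt ↦ hp ?_)
      have h2 : ((2 : ℤ) : ℤ_[p]) = 2 := by norm_cast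
      rw [← h2, PadicInt.norm_int_lt_one_iff_dvd] at hlt
      have hdvd : p ∣ 2 := by exact_mod_cast hlt
      exact (Nat.prime_dvd_prime_iff_eq (Fact.out : p.Prime) Nat.prime_two).mp hdvd
    refine ⟨(h2u.unit⁻¹ : ℤ_[p]ˣ) * x, ?_⟩
    rw [← two_mul, ← mul_assoc, IsUnit.mul_val_inv, one_mul]
  -- `g ∈ Γ_ℚ` with `χ_p(g) = γ_cyc^w`, and `g² = res σ`
  obtain ⟨g, hg⟩ := GaloisRep.cyclotomicCharacter_rat_surjective p (cycPowUnit p w)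
  obtain ⟨σ, hσ⟩ := sq_mem_range_absGaloisRestrict_of_finrank_eq_two L h2 g
  refine ⟨σ, ?_⟩
  haveI : NeZero (p : ℚ) := ⟨by exact_mod_cast (Fact.out : p.Prime).ne_zero⟩
  rw [← cyclotomicCharacter_absGaloisRestrict ℚ L p σ, hσ, map_pow, hg, pow_two,
    cycPowUnit_mul_cycPowUnit, hw]

/-- **The cyclotomic `ℤ_p`-extension of a quadratic field, constructed** (`[L : ℚ] = 2`, `p` odd):
there is a `ℤ_p`-extension `κ` of `L` which is CYCLOTOMIC (`ker κ = χ_p⁻¹(μ(ℤ_p))`, i.e.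
`L_∞ = L·ℚ_∞ ⊆ L(μ_{p^∞})`), given by `κ(σ) = ℓ(χ_p(σ))` with the tree's normalised logarithm
`ℓ = CyclotomicZp.ell p` (`ℓ(γ_cyc^x) = x`, `ker ℓ = μ(ℤ_p)`), together with a NORMALISED topological
generator `γ ∈ Γ_L`: `κ(γ) = 1` and `χ_p(γ) = γ_cyc = 1 + p`. (Washington §13.1; the quadratic twin
of the tree's `CyclotomicZp.zpExtension` / `exists_isTopGenerator_zpExtension` over `ℚ`.)
[cite: Washington1997, §13.1] -/
theorem exists_zpExtension_isCyclotomic_of_finrank_eq_two (h2 : Module.finrank ℚ L = 2)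
    (hp : p ≠ 2) :
    ∃ κ : ZpExtension L p, κ.IsCyclotomic ∧
      (∀ σ, κ σ = Multiplicative.ofAdd (ell p (GaloisRep.cyclotomicCharacter L p σ))) ∧
      ∃ γ : absoluteGaloisGroup L, κ.IsTopGenerator γ ∧
        ((GaloisRep.cyclotomicCharacter L p γ : ℤ_[p]ˣ) : ℤ_[p]) = (cyclotomicGenerator p : ℤ_[p]) := by
  let κ : ZpExtension L p :=
    { toContinuousMonoidHom := (ellHom p).comp (GaloisRep.cyclotomicCharacter L p)
      surjective := by
        intro y
        obtain ⟨σ, hσ⟩ := exists_cyclotomicCharacter_eq_cycPowUnit L p h2 hp y.toAdd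
        refine ⟨σ, ?_⟩
        change ellHom p (GaloisRep.cyclotomicCharacter L p σ) = y
        rw [hσ, ellHom_apply, ell_cycPowUnit, ofAdd_toAdd] }
  have hκ : ∀ σ, κ σ = Multiplicative.ofAdd (ell p (GaloisRep.cyclotomicCharacter L p σ)) :=
    fun _ ↦ rfl
  refine ⟨κ, ?_, hκ, ?_⟩
  · ext σ
    rw [ZpExtension.mem_kerSubgroup, Subgroup.mem_comap, CommGroup.mem_torsion, hκ, ofAdd_eq_one,
      ell_eq_zero_iff]
    rfl
  · obtain ⟨γ, hγ⟩ := exists_cyclotomicCharacter_eq_cycPowUnit L p h2 hp 1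
    refine ⟨γ, ?_, ?_⟩
    · rw [ZpExtension.IsTopGenerator, hκ, hγ, ell_cycPowUnit]
    · rw [hγ, val_cycPowUnit, cycPow_one]

end Quadratic

/-! ### `K = ℚ(ζ₃)`, `p = 3`: the hypothesis `hexK` of line V14, discharged -/

section CyclotomicThree

variable (K : Type) [Field K] [NumberField K] [IsCyclotomicExtension {3} ℚ K]

/-- **`hexK` holds**: `K = ℚ(ζ₃)` has a cyclotomic `ℤ₃`-extension `κ` (`K_∞ = ℚ(μ_{3^∞})`) with a
topological generator `γ ∈ Γ_K`, `κ(γ) = 1`, and `χ₃(γ)·ζ = γ_cyc = 4` for a root of unity `ζ ∈ ℤ₃ˣ`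
(here `ζ = 1`) — literally the inline hypothesis `hexK` of
`X3CyclotomicThree.exists_padicVal_shaOrder_add_le` and its corollaries. [cite: Washington1997, §13.1] -/
theorem exists_isCyclotomic_isTopGenerator_cyclotomicThree :
    ∃ κ : ZpExtension K 3, κ.IsCyclotomic ∧ ∃ γ : absoluteGaloisGroup K,
      κ.IsTopGenerator γ ∧ ∃ ζ : ℤ_[3]ˣ, IsOfFinOrder ζ ∧
        ((GaloisRep.cyclotomicCharacter K 3 γ * ζ : ℤ_[3]ˣ) : ℤ_[3]) =
          (cyclotomicGenerator 3 : ℤ_[3]) := by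
  obtain ⟨κ, hκ, -, γ, hγ, hχ⟩ := exists_zpExtension_isCyclotomic_of_finrank_eq_two K 3
    (finrank_eq_two_of_isCyclotomicExtension_three (K := K)) (by norm_num)
  exact ⟨κ, hκ, γ, hγ, 1, IsOfFinOrder.one, by rw [mul_one, hχ]⟩

end CyclotomicThree

end Summit.BirchSwinnertonDyer.Rank1Residual.Additive

end
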